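import Mathlib
import HarnessLib
import HarnessLib.Audit
import Summits.AtomisticToContinuum.Statement
import Literature.MathematicalPhysics.StatisticalMechanics.StickyChain

/-!
Route: SlackFreeD4

CLOSED (retired) 2026-08-15T13:46:37Z by operator:999:1257524 — reason: not-a-thesis: assembly does not conclude the sub-problem Statement — note: D-0027 §2.1 audit (human 2026-08-15: routes that do not decide the summit are removed): the assembly concludes `D4Crystallization`, not the sub-problem statement; a NEW conforming route may be opened from the same idea (generated `closes : … → _root_.Crystallization`).. The file is kept as the record of this route; refuted decls are indexed as negative knowledge (`ledger negatives`).

# Route SlackFreeD4 — slack-free dimension four: 24-cell kissing uniqueness makes 24-kissed packings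
D4, so hard sticky spheres crystallize onto D4 (both Blanc–Lewin conjuncts) and Mie wells reduce to
Theil accounting

ANALOGUE RUNG (declared): X does NOT imply `Summit.AtomisticToContinuum.Crystallization`
(Lennard-Jones in d = 3); frame #1 (X → summit) is not claimed and the Assembly closes X
(precedents: SabraStatics, Parity/CubicRoots). It suffices to show X = STICKY ∧ MIE, realising card
slack-free-dimension-four-d4 (absorbing the retired duplicates dimension-four-d4-kissing-rung,
e8-leech-sticky-rung-kissing-tight): the KISSING SLACK s_d (largest minimal angle of a k(d)-point
code on S^(d−1) minus 60°) vanishes for d = 4 (de Laat–Leijenhorst–de Muinck Keizer 2024: the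
24-cell root shell is the unique 24-point kissing configuration), and both catalogued 3-D
obstructions are functions of the slack.
STICKY (hard sticky spheres = contact-maximising packings of unit-diameter balls in R^4; both
Blanc–Lewin conjuncts WITH the limit named): (i) the minimal sticky energy over N-point packings
(minus the maximal contact number c₄(N)) satisfies E_hc(N)/N → −12, and −12 is the minimum of the
sticky energy per particle over periodic packings of R^4, attained by D4 = 2^(−1/2)·(even-sum
integer vectors); (ii) every sequence of contact-maximising N-packings has a subsequence which,
translated, converges locally (against every continuous compactly supported f) to the counting
measure of ONE rotated D4 lattice A(D4), multiplicity one.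
MIE (Lennard-Jones-type wells one dimension up): there is q₀ such that for every q ≥ q₀ the Mie
potential V_q(r) = r^(−2q)/(2q) − r^(−q)/q (V₆ is the tree's lennardJones, up to notation) satisfies
the tree's own predicates HasPeriodicGroundStateEnergy V_q 4 ∧ IsCrystallizing V_q 4.
The hard core is typed as a constraint (minimise the tree's stickyPotential energy among
configurations with pairwise distances ≥ 1) because the tree's finite-penalty stickyPotential is
catastrophically unstable in R^4 (support PenaltyStickyUnstableFour: Lenz's two orthogonal circles
give E(4m) ≤ −2m² − 2m).
Lean: `((Filter.Tendsto (fun N : ℕ => (⨅ x : {x : Fin N → EuclideanSpace ℝ (Fin 4) // ∀ i j : Fin N,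
i ≠ j → 1 ≤ dist (x i) (x j)}, Literature.MathematicalPhysics.StatisticalMechanics.interactionEnergy
Literature.MathematicalPhysics.StatisticalMechanics.stickyPotential x.1) / (N : ℝ)) Filter.atTop
(nhds (-12))) ∧ (∀ P : Literature.MathematicalPhysics.StatisticalMechanics.PeriodicConfiguration 4,
(∀ a ∈ P.points, ∀ b ∈ P.points, dist a b < 1 → a = b) → (-12 : ℝ) ≤ P.energyPerParticle
Literature.MathematicalPhysics.StatisticalMechanics.stickyPotential) ∧ (∃ P :
Literature.MathematicalPhysics.StatisticalMechanics.PeriodicConfiguration 4, P.points = {u :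
EuclideanSpace ℝ (Fin 4) | ∃ z : Fin 4 → ℤ, Even (∑ k, z k) ∧ ∀ k, u k = (z k : ℝ) / Real.sqrt 2} ∧
P.energyPerParticle Literature.MathematicalPhysics.StatisticalMechanics.stickyPotential = -12) ∧ (∀
x : (N : ℕ) → (Fin N → EuclideanSpace ℝ (Fin 4)), (∀ N, ((∀ i j : Fin N, i ≠ j → 1 ≤ dist ((x N) i)
((x N) j)) ∧ ∀ y : Fin N → EuclideanSpace ℝ (Fin 4), (∀ i j : Fin N, i ≠ j → 1 ≤ dist (y i) (y j)) →
Literature.MathematicalPhysics.StatisticalMechanics.interactionEnergy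
Literature.MathematicalPhysics.StatisticalMechanics.stickyPotential (x N) ≤
Literature.MathematicalPhysics.StatisticalMechanics.interactionEnergy
Literature.MathematicalPhysics.StatisticalMechanics.stickyPotential y)) → ∃ (φ : ℕ → ℕ) (τ : ℕ →
EuclideanSpace ℝ (Fin 4)) (A : EuclideanSpace ℝ (Fin 4) ≃ₗᵢ[ℝ] EuclideanSpace ℝ (Fin 4)), StrictMono
φ ∧ ∀ f : EuclideanSpace ℝ (Fin 4) → ℝ, Continuous f → HasCompactSupport f → Filter.Tendsto (fun j
=> ∑ i : Fin (φ j), f (x (φ j) i + τ j)) Filter.atTop (nhds (∑' s : ↥(A '' {u : EuclideanSpace ℝ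
(Fin 4) | ∃ z : Fin 4 → ℤ, Even (∑ k, z k) ∧ ∀ k, u k = (z k : ℝ) / Real.sqrt 2}), f s.1)))) ∧ (∃ q₀
: ℕ, ∀ q : ℕ, q₀ ≤ q →
Literature.MathematicalPhysics.StatisticalMechanics.HasPeriodicGroundStateEnergy (fun r : ℝ => (r⁻¹)
^ (2 * q) / (2 * (q : ℝ)) - (r⁻¹) ^ q / (q : ℝ)) 4 ∧
Literature.MathematicalPhysics.StatisticalMechanics.IsCrystallizing (fun r : ℝ => (r⁻¹) ^ (2 * q) /
(2 * (q : ℝ)) - (r⁻¹) ^ q / (q : ℝ)) 4)`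

## Assembly
Pure logic, proved as `assembly_trivial` in the planner's Sketch.lean (axioms
propext/choice/Quot.sound): from KissingFourClassification (rank 2), FejesTothFourOfKissing (rank 4)
and HardStickyWindows (rank 5) the support StickyD4OfWindows yields STICKY; SoftFejesTothFour
applied to ranks 4 and 2 yields the soft patch property, which MieD4OfSoftKissing (rank 3) and rank
2 turn into MIE; the pair is the target D4Crystallization. The chain ends at the rung target, not at
Summit.AtomisticToContinuum.Crystallization (analogue rung, declared in § Thesis).

Rationale: WHY THIS LINE. Every proved crystallization theorem for a pair potential (HeitmannRadin1980, Radin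
1981, Theil2006, ELi2008, De Luca–Friesecke) runs on the fact that in the plane the kissing
configuration is RIGID and UNIQUE and maximal coordination propagates to one lattice; in d = 3 both
steps fail (barriers FlexibleKissingArrangements: s₃ = 3.43° of icosahedral slack;
KissingTwelveDegeneracy: twelve contacts give the uncountable Barlow family, Hales2012), and every d
= 3 route of this summit spends its effort buying the slack back (robust Fejes Tóth 0758, stacking
selection, two-shell certificates). In d = 4 the slack is ZERO: Musin2008 gives k(4) = 24 and
DeLaatLeijenhorstDeMuinckKeizer2024 (arXiv:2404.18794, Lemma 5.1 + Thm 5.3, exact Lasserre-2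
certificate) give uniqueness and root-system rigidity of the 24-shell; a half-page propagation lemma
(the cube link of a root plus the root has reflection closure all of D4 — verified by computation
here) then makes "every 24-kissed packing of R^4 is the D4 lattice" a theorem with ONE lattice as
conclusion, so the Heitmann–Radin contact-budget scheme closes in d = 4 exactly as in d = 2, and
Theil's soft scheme needs no stacking-selection step. Imported areas: coding theory / semidefinite
optimisation (the 2024 uniqueness certificate), root systems and regular polytopes (24-cell, F4
symmetry, covering radius of D4: ConwaySloane1999 Ch. 4), rigidity theory of spherical codes
(CohnJiaoKumarTorquato2011 Prop 3.1: the D4 root system is infinitesimally jammed, giving a linear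
local modulus for the soft step), and the physics of 4-D liquids as sanity check
(VanmeelFrenkelCharbonneau2009, Hoy2024: the 25-atom 24-cell cluster is locally preferred AND tiles
as D4; 4-D Lennard-Jones liquids crystallize homogeneously into D4). What the line does that prior
routes do not: it is the only route of the summit whose local-rigidity step is a published theorem
rather than a crux, it produces a complete Blanc–Lewin-type theorem (both conjuncts, off-lattice,
isotropic pair interaction) above the plane, and it calibrates the d = 3 routes: each of their
cruxes is "slack × device" (link census prices s₃, two-shell rigidity and octet trusses restore
rigidity one shell out), measured here against the world where the price is zero. No Fourier/LP
certificate is used (Li2022 covers d = 4: the Cohn–Elkies bound is not sharp there), so this is the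
geometric complement of the magic-function ladder (card
zero-pressure-magic-function-dimension-ladder), not a competitor.

RANKED CRUXES. #0 D4Crystallization (target) — X = STICKY ∧ MIE as in § Thesis: (STICKY) E_hc(N)/N →
−12 for contact-maximising packings of R^4, −12 = min of the sticky energy per particle over
periodic packings, attained by D4, and translated subsequences of contact-maximising packings
converge locally to the counting measure of one rotated D4 (multiplicity one); (MIE) ∃ q₀ ∀ q ≥ q₀,
HasPeriodicGroundStateEnergy V_q 4 ∧ IsCrystallizing V_q 4 for the Mie potential V_q(r) =
r^(−2q)/(2q) − r^(−q)/q. Analogue rung: does not imply the d = 3 summit. (why it might fail: STICKY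
only if KissingFourClassification is wrong in print; MIE if for every q some arrangement with ≤ 24
near-contacts but a denser second shell beats a*(q)·D4 in the r^(−q) tail, or if 4-D Mie ground
states keep a positive defect density (then Blanc–Lewin (ii) fails in the exact-lattice form).)
[DeLaatLeijenhorstDeMuinckKeizer2024, Musin2008, HeitmannRadin1980, Theil2006, BlancLewin2015,
Hoy2024]
#2 KissingFourClassification (crux) — NAMED FACT IN PRINT, isolated as the first crux because it is
the only input of the line not proved in Lean: (i) k(4) = 24 — at most 24 unit vectors of R^4 are
pairwise at distance ≥ 1 (Musin 2008, Theorem; also the objective value 24 of the exact Lasserre-2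
solution of arXiv:2404.18794); (ii) every configuration of 24 unit vectors pairwise at distance ≥ 1
is the image of the normalised D4 root system 2^(−1/2)·(integer z with Σ z_k² = 2) under a linear
isometry (de Laat–Leijenhorst–de Muinck Keizer 2024, Lemma 5.1: all inner products in −1, ±1/2, 0;
Theorem 5.3: root-system closure, or Cohn's three-orthonormal-bases argument). Formal debt =
verification of the public rational certificate (Julia/Nemo data of arXiv:2404.18794 §5.1) or a Lean
port of Musin's proof; no mathematical novelty is claimed for this item. [difficulty: XL] (why it
might fail: Only if the published exact SDP certificate (arXiv:2404.18794 §5.1: rational affine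
constraints, PSD factors B·X·Bᵀ checked by Cholesky in ball arithmetic, Sturm sequences for p₂) is
in error; the Lean debt (degree-16 zonal matrices) is XL — a formal risk, not a mathematical one.)
[Musin2008, DeLaatLeijenhorstDeMuinckKeizer2024, arXiv:2404.18794, ConwaySloane1999]
#3 MieD4OfSoftKissing (crux) — THEIL ONE DIMENSION UP, GIVEN THE GEOMETRY (card N4–N5): assuming the
soft Fejes Tóth–D4 patch property (verbatim the conclusion of support SoftFejesTothFour: for all R,
ε there is η such that every (1−η)-separated S ∋ p all of whose points within R of p have ≥ 24 other
points of S within 1+η is, on the closed ball of radius R−2 about p, ε-close in both directions to p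
+ A(D4) for a linear isometry A) and KissingFourClassification, there is q₀ such that
HasPeriodicGroundStateEnergy V_q 4 ∧ IsCrystallizing V_q 4 for all q ≥ q₀, V_q(r) = r^(−2q)/(2q) −
r^(−q)/q (tree predicates, d = 4). Intended proof = Theil 2006 with the planar bond-graph
combinatorics replaced by 24-kissing rigidity: minimum distance 1 − η(q) for ground states (Theil
Lemma 2.2); at most 24 neighbours within 1+η and a bond deficit ≥ 1/2 per defective particle (Theil
Prop. 2.3 ↦ KissingFourClassification (i) + compactness); renormalised potential V*(a) = (1/24)·Σ
over D4∖0 of V_q(a|v|), minimised at a*(q) < 1; defect-free patches enter the harmonic basin of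
a*(q)·D4 by the soft patch property and stay Cauchy–Born-close by a quadratic rigidity modulus of
the D4 contact truss (Friesecke–James–Müller type; first-order input: the D4 root system is
infinitesimally jammed, CJKT 2011 Prop. 3.1); tail controlled by |V_q''(r)| ≲ r^(−q−2), summable
against |v|² over D4 since q > 4; exact windows up to o(1) distortion + compactness of O(4) give
IsCrystallizing, periodisation of a*(q)·D4 blocks gives the energy conjunct with the periodic
minimum attained at a*(q)·D4. [deps: KissingFourClassification, FejesTothFourOfKissing,
SoftFejesTothFour] [difficulty: XL] (why it might fail: For fixed q the tail (61 % of e(D4) at q =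
6, 24 % at q = 8) must be dominated patch by patch although a*(q) < 1; a denser non-D4 second shell
compatible with ≤ 24 near-contacts would break the one-centre step, and Blanc–Lewin (ii) needs an
unproved quadratic rigidity modulus of the D4 truss.) [Theil2006, FrieseckeJamesMuller2002,
CohnJiaoKumarTorquato2011, ELi2008, BlancLewin2015, Hoy2024, FlatleyTheil2015]
#4 FejesTothFourOfKissing (crux) — THE FEJES TÓTH THEOREM OF R^4, LOCAL PATCH FORM (new; card N2):
given KissingFourClassification, if S ⊂ R^4 has pairwise distances ≥ 1, p ∈ S, and every point of S
within distance R of p is at distance exactly 1 from exactly 24 points of S, then on the closed ball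
of radius R−1 about p the set S coincides with p + A(D4), D4 = 2^(−1/2)·(even-sum integer vectors),
for a linear isometry A. Mechanism (checked by computation in the planner folder): the shell of a
24-kissed point is a rotated root shell (rank 2 (ii)); two touching 24-kissed points x and x+r share
x and the 8 common neighbours x+s with ⟨s,r⟩ = 1/2 — seen from x+r these are the root −r and its
cube link, 9 roots of rank 4 whose reflection closure is all 24 roots — so the neighbour's shell is
the SAME rotated root system (propagation, no branching: contrast the A/B/C choice behind
FejesTothKissingTwelve); every lattice vector w ≠ 0 has a root ρ with ⟨w,ρ⟩ ≥ |ρ|² > |ρ|²/2, so root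
paths with monotone distance to p reach every lattice point of the R-ball (all occupied); the
covering radius 2^(−1/2) < 1 of D4 leaves no room for a non-lattice point inside radius R−1.
Corollary (R → ∞): a packing of R^4 in which every ball touches 24 others is the D4 lattice packing
— one Bravais lattice, no stacking family. [deps: KissingFourClassification] [difficulty: M] (why it
might fail: Only through a slip in the propagation bookkeeping (a second rotated root system through
−r and its 8-point link) or in the boundary layer R−1 < dist ≤ R; both were checked by hand and by
computation, and one non-D4 24-kissed packing of R^4 refutes it outright.)
[DeLaatLeijenhorstDeMuinckKeizer2024, Hales2012, HalesDSP2012, ConwaySloane1999]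
#5 HardStickyWindows (crux) — FINITE-N CORE OF THE STICKY RUNG (card N3): given
FejesTothFourOfKissing and KissingFourClassification, for every R there is N₀ such that every
contact-maximising packing x of N ≥ N₀ unit-diameter balls in R^4 (a minimiser of the tree's sticky
energy among configurations with pairwise distances ≥ 1) has a centre x_i around which, on the
closed R-ball, the configuration is EXACTLY x_i + A(D4) for a linear isometry A. Proof plan
(Heitmann–Radin contact budget): contacts ≤ 24 per ball (rank 2 (i)) and D4 boxes with a partial
layer give 12N − C·N^(3/4) ≤ c₄(N) ≤ 12N, so at most 2C·N^(3/4) balls are not 24-kissed; a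
1-separated set has ≤ c·(R+2)⁴ points in an (R+1)-ball, so for N > (2cC(R+3)⁴)⁴ some ball sees only
24-kissed balls within R+1, and rank 4 gives the window. [deps: KissingFourClassification,
FejesTothFourOfKissing] [difficulty: M] (why it might fail: Hardly, once ranks 2 and 4 stand
(counting + pigeonhole); the one trap is the trial-state bound c₄(N) ≥ 12N − C·N^(3/4) for EVERY N
(D4 boxes plus a partial layer), which needs explicit lattice-point counting in Lean.)
[HeitmannRadin1980, BezdekKhan2018, Bezdek2011, Hales2012]
#9 StickyD4OfWindows (support) — GLUE FOR STICKY: KissingFourClassification → FejesTothFourOfKissing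
→ HardStickyWindows → STICKY (verbatim the first conjunct of the target). Energy part: −12N ≤
E_hc(N) (rank 2 (i)) and E_hc(N) ≤ −12N + C·N^(3/4) (D4 boxes); periodic packings have ≤ 24 contacts
per point (rank 2 (i)), so e ≥ −12, and the PeriodicConfiguration with lattice D4 and motif 0 has e
= −12 (24 minimal vectors, nothing else within range). Positional part: radii R_j = j, indices φ(j)
≥ N₀(j+1) strictly increasing, τ_j = −(window centre), rotations A_j from HardStickyWindows; extract
A_j → A in the compact group O(4); for f supported in B(0,R₀) the sums are eventually the FINITE
sums Σ over v ∈ D4 with |v| ≤ R₀+1 of f(A_j v) → Σ f(A v) = ∑' over A(D4) by continuity of f (no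
approximate matching needed; CrystallizationLocalLimit has the periodic-measure API if the
Blanc–Lewin shape with PeriodicConfiguration.isometryImage is preferred). [difficulty: provable-now]
[BlancLewin2015, HeitmannRadin1980]
#9 SoftFejesTothFour (support) — SOFT FEJES TÓTH–D4 BY COMPACTNESS (qualitative robust 24-kissing,
the d = 4 counterpart of crux RobustFejesTothHales of route CrystalKissingRigidity — here a
corollary, because s₄ = 0): given FejesTothFourOfKissing and KissingFourClassification, for all R
and ε > 0 there is η > 0 such that every (1−η)-separated S ∋ p all of whose points within R of p
have at least 24 other points of S within 1+η is, on the closed ball of radius R−2 about p, ε-close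
to p + A(D4) in both directions (every point within ε of a site, every site within ε of a point),
for a linear isometry A. Proof: contradiction sequence η_n → 0; translate p to 0; the boundedly many
points in the closed (R+3)-ball converge along a subsequence; the limit is a packing whose points
within R − 1/2 of 0 are exactly 24-kissed (≥ 24 limit neighbours at distance ≤ 1, hence = 1 and ≤ 24
by rank 2 (i)), so rank 4 pins it on the closed (R−3/2)-ball ⊇ (R−2)-ball, contradiction. A LINEAR
modulus ε ≤ C(R)·η follows near each shell from infinitesimal jamming of the D4 root system
(Cohn–Jiao–Kumar–Torquato 2011, Prop. 3.1) and is left to layer 2. [difficulty: provable-now]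
[CohnJiaoKumarTorquato2011, DeLaatLeijenhorstDeMuinckKeizer2024, KusnerKusnerLagariasShlosman2018,
Hales2012]
#9 PenaltyStickyUnstableFour (support) — WHY THE RUNG IS TYPED WITH A HARD CORE (negative, provable
now): the tree's finite-penalty stickyPotential (+1 on [0,1), −1 at 1, 0 beyond; StickyChain.lean,
meant for d = 1) is catastrophically unstable in R^4, hence ¬HasPeriodicGroundStateEnergy
stickyPotential 4: Lenz's two orthogonal circles of radius 2^(−1/2) (coordinates 1–2 and 3–4) carry
2m + 2m RATIONAL points arranged as two tight antipodal clusters per circle; all 4m² cross pairs are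
at distance exactly 1 and only the 2m² − 2m intra-cluster pairs are closer than 1, so E(4m) ≤ (2m² −
2m) − 4m² = −2m² − 2m and E(N)/N is unbounded below (groundStateEnergy_le_of_le with c = −1),
whereas convergence of E(N)/N to the finite energy per particle of some periodic configuration is
what HasPeriodicGroundStateEnergy asserts. (The d = 1 theorems of StickyChainCrystallization are
unaffected; in d = 4 the hard core must be a constraint.) [difficulty: provable-now]
[BlancLewin2015, doi:10.1007/s00454-008-9082-x]

TWO-LAYER PLAN. Foreseen glued splits (k ≤ 3, depth 1), none filed now. MieD4OfSoftKissing ⇐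
MieFourMinimumDistance (Theil Lemma 2.2 in d = 4: ground states are (1−η(q))-separated and all but
C·N^(3/4) particles have exactly 24 neighbours within 1+η, via the one-centre bond deficit) →
MieFourLocalLaw (renormalised-potential one-centre inequality with defect gap 1/2 and quadratic
modulus on defect-free patches, FJM/jamming input) → MieFourGlue (windows + O(4) compactness +
periodisation of a*(q)·D4 ⇒ both predicates). KissingFourClassification ⇐ KissingFourBound (k(4) ≤
24) → KissingFourInnerProducts (arXiv:2404.18794 Lemma 5.1: inner products in −1, ±1/2, 0) → glue
"inner products ⇒ isometric to the root shell" (elementary: antipodality from the bound, reflection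
closure, 3 orthonormal bases). FejesTothFourOfKissing ⇐ PropagationLemma (adjacent 24-kissed points
carry the same rotated root system) → ReachabilityCovering (monotone root paths; covering radius
2^(−1/2)) → patch. SoftFejesTothFour may later acquire a quantitative child (linear modulus from
CJKT Prop. 3.1) if rank 3's prover needs it.

KILL CRITERIA. A packing of R^4 in which every ball touches 24 others that is NOT the D4 lattice
(equivalently: two distinct rotated D4 root systems sharing a root and its 8-point link) refutes
FejesTothFourOfKissing's conclusion and with it the whole slack-free thesis: close
`refuted:FejesTothFourOfKissing`. An error found in the published certificate of arXiv:2404.18794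
(KissingFourClassification (ii) open again) blocks the route: pivot to the conditional form
"uniqueness ⇒ X" and wait. MieD4OfSoftKissing refuted (a proof that 4-D Mie ground states keep a
positive defect density for all large q, or a periodic competitor beating a*(q)·D4 for infinitely
many q) kills only the MIE conjunct: restate the target to STICKY and keep ranks 2, 4, 5 (pivot, not
closure). HardStickyWindows cannot fail independently of ranks 2 and 4. STICKY proved elsewhere
(e.g. by a direct Heitmann–Radin-style argument) moots ranks 4–5 but not rank 3.

NOT DECOMPOSED YET. The Theil-type internals of rank 3 (minimum distance, one-centre law with the
renormalised potential and a*(q), the FJM/jamming modulus of the D4 truss, periodisation) — layer-2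
children once SoftFejesTothFour or rank 4 closes; the value of q₀ and the genuine Lennard-Jones case
q = 6 in d = 4 (stretch: needs 4-D tail certificates at 3 % slack, three-point/Lasserre density
technology of Cohn–de Laat–Salmon, CohnLaatSalmon2022); the linear modulus in SoftFejesTothFour; the
d = 8, 24 corollaries of rank 4's argument (E8/Leech via Bannai–Sloane uniqueness of the 240/196560
shells and of the 56/4600 links, ConwaySloane1999 Ch. 14) — support statements for a later edit, not
items now; the certificate port behind rank 2; the Blanc–Lewin-shape corollary of STICKY via
PeriodicConfiguration.isometryImage (bookkeeping).

CHEAPEST FALSIFIER. Rank 4 is cheap to attack and was attacked here first: (a) algebra — the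
reflection closure of the 9 roots (−r and the cube link of r) is all 24 roots, they have rank 4,
every non-zero D4 vector w has a root ρ with ⟨w,ρ⟩ ≥ |ρ|², and the covering radius of D4 is
2^(−1/2)·(minimal distance) (python check in the planner folder, all passed); (b) search — enumerate
the known 4-D packings with high kissing numbers (D4; its non-lattice relatives obtained by
fibering/laminating, ConwaySloane1999 Ch. 4–6 and Conway–Sloane 1995 "What are all the best sphere
packings in low dimensions?"; A4, A4*, Z^4) and check whether any non-D4 packing has 24 contacts at
EVERY ball — one example kills the route. For rank 3 the cheapest check is a lattice-sum table: e(Q)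
for Mie (2q,q), q = 6, 8, 10, over D4, A4, Z^4, F4-scalings and the densest known 4-D periodic
non-lattice packings (the card's sums: q = 6: e(D4) = −2.105 at a* = 0.942 vs e(A4) = −1.871, e(Z^4)
= −1.069); any periodic Q with e(Q) < e(a*·D4) for large q contradicts the mechanism (not the
Blanc–Lewin statement itself).

NUMBERS. k(4) = 24 (Musin2008); uniqueness of the 24-shell and inner products in −1, ±1/2, 0
(DeLaatLeijenhorstDeMuinckKeizer2024, Lemma 5.1, Thm 5.3; certificate: d₁ = 14, d₂ = δ = 16, 40
digits, rational rounding in 4 h, verification under 2 days + 2 h). D4 at minimal distance 1 (=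
2^(−1/2)·even-sum Z^4): shells 24 @ 1, 24 @ √2, 96 @ √3, 24 @ 2, 144 @ √5; covering radius 2^(−1/2);
|Aut(24-cell)| = 1152, vertex stabiliser 48 = |Sym(cube)|; each root has 8 roots at 60°, 6 at 90°, 8
at 120°, 1 antipode. Sticky: e(D4) = −12, contact deficit exponent (d−1)/d = 3/4 (BezdekKhan2018
Cor. 7.2: c(n,4) < 12n − 2^(−4)·δ₄^(−3/4)·n^(3/4)). Penalty potential: Lenz configuration E(4m) ≤
−2m² − 2m. Mie in d = 4 (card's lattice sums): (12,6): e(D4) = −2.105 at a* = 0.942 (tail 61 %),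
e(A4) = −1.871, e(Z^4) = −1.069; (16,8): e(D4) = −0.967 at a* = 0.985 (first shell 76 %, tail
−0.230; a missing half-bond costs 1/32 = 0.031 > 13 % of the tail). D4 root system infinitesimally
jammed (CohnJiaoKumarTorquato2011 Prop. 3.1). Items at open: 9 (1 target, 4 cruxes, 3 support, 1
assembly).

DEFINITION REQUESTS. None blocking: every item is typed over Mathlib +
Literature.MathematicalPhysics.StatisticalMechanics.Crystallization (+ StickyChain for
stickyPotential), with D4 inlined as the set of u with u_k = z_k/√2, z ∈ Z^4 of even sum.
Conveniences worth filing once a prover asks (they would shorten every statement): `dFourLattice :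
PeriodicConfiguration 4` (lattice 2^(−1/2)·D4, motif 0) and `IsHardStickyGroundState` (minimiser of
the sticky energy among 1-separated configurations) in
Literature/MathematicalPhysics/StatisticalMechanics; named facts `Musin2008_kissingFour` /
`DLLdMK2024_kissingFourUnique` in Literature/Geometry/DiscreteGeometry mirroring
KissingFourClassification (i)/(ii) (cite items to be filed by the planner after open).

Novelty: Searches (2026-08-15): `lit search --source crossref "sphere packing four dimensions every sphere
touches 24 others D4 lattice characterization"` (13 rows, none relevant); `lit search --source
zbmath "rigidity spherical codes kissing configurations jammed"` (1: arXiv:1102.5060, read Prop.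
3.1); `lit search --source crossref "Hoy 2024 four-dimensional Lennard-Jones crystallization"`
(doi:10.1103/physreve.109.044604, read p. 1); `lit read arXiv:2404.18794` pp. 2–4, 16–18 (Lemma 5.1,
Thm 5.2–5.3 and Cohn's alternative proof); `lit frontier AtomisticToContinuum --since 2022` (30
rows: only planar work, arXiv:2407.20762); `lit bridges AtomisticToContinuum --cross any` (nothing
in d = 4); `ledger negatives --problem AtomisticToContinuum` (0); the 108 cards of the sub
(duplicates dimension-four-d4-kissing-rung, e8-leech-sticky-rung-kissing-tight retired as superseded
by this card) and the three novelty audits of the card (refuters 7/9/14: crossref, zbMATH, SPLAG Ch.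
14 read — no "24-kissed packings are D4", no Blanc–Lewin-type theorem in d = 4); arXiv/OpenAlex APIs
returned 429 and searchd/galaxy were saturated this session (logged in NOTES.md).
Nearest prior art found: DeLaatLeijenhorstDeMuinckKeizer2024 (arXiv:2404.18794) — uniqueness of the
24-point kissing configuration, pure coding theory, no packing-propagation or energy statement;
Hales2012 (arXiv:1209.6043) — the d = 3 analogue whose conclusion is the Barlow FAMILY;
HeitmannRadin1980 — the d = 2 contact-budget scheme being l  [refs: 10.1103/physreve.109.044604, 1102.5060, 2404.18794, 2407.20762, 1209.6043, doi:10.1103/physreve.109.044604, DeLaatLeijenhorstDeMuinckKeizer2024, Hales2012, HeitmannRadin1980, CohnJiaoKumarTorquato2011, Theil2006, VanmeelFrenkelCharbonneau2009, Hoy2024, ConwaySloane1999]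

Barriers (technique_class: dimension-ladder kissing-number sphere-packing-reduction): - technique_class: dimension-ladder kissing-number sphere-packing-reduction
- Literature.Barriers.AtomisticToContinuum.KissingTwelveDegeneracy: dimension-specific — its
witnesses (Barlow stackings: twelve contacts everywhere, uncountably many, aperiodic ones included)
have no d = 4 counterpart: FejesTothFourOfKissing says 24 contacts everywhere force the single
lattice D4; contact maximisation is used only in d = 4 and nothing is claimed in d = 3.
- Literature.Barriers.AtomisticToContinuum.FlexibleKissingArrangements: the icosahedral flexible
shell exists because s₃ = 3.43° > 0; in d = 4 the count-only single-shell inference it forbids is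
TRUE (KissingFourClassification (ii): 24 unit vectors pairwise ≥ 1 apart form a root shell,
first-order rigid by CohnJiaoKumarTorquato2011 Prop. 3.1) — evaded by the change of dimension that
is the thesis, not inside d = 3.
- Literature.Barriers.AtomisticToContinuum.FlexibleKissingArrangementsNarrow: same remark; no
bond-count or second-shell hypothesis is needed in d = 4.
- Literature.Barriers.AtomisticToContinuum.IcosahedralClusters: finite-cluster statements in d = 3;
in d = 4 the 25-ball cluster 0 ∪ 24-cell has 24 + 96 unit bonds and no spread-out competitor (s₄ =
0), but finite-N exactness is NOT claimed: HardStickyWindows allows 2C·N^(3/4) defective balls and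
asserts exact windows only.
- Literature.Barriers.AtomisticToContinuum.StickySphereClusters: same scope — degeneracy of small
maximal-contact clusters (polytetrahedral motifs exis

History (route lifecycle, newest last):
- 2026-08-15T13:46:37Z · CLOSED retired — not-a-thesis: assembly does not conclude the sub-problem Statement (operator:999:1257524)

sub-problem: Crystallization · status: closed(retired) · opened planner-plancard-AtomisticToContinuum-Crystal-801539d7-0 2026-08-15T11:46:03Z · rev 0 · ledger route-AtomisticToContinuum-SlackFreeD4
GENERATED by the gate from the ledger (D-0016/17). Provers cite these decls: `theorem foo : Summit.AtomisticToContinuum.Crystallization.Theses.SlackFreeD4.<Decl> := …` in Summits/AtomisticToContinuum/Crystallization/Theorems/<Name>.lean.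
-/

namespace Summit.AtomisticToContinuum.Crystallization.Theses.SlackFreeD4

open scoped BigOperators Topology Manifold Classical MeasureTheory ProbabilityTheory Matrix InnerProductSpace ComplexConjugate ContinuousMap
open Filter Set Function TopologicalSpace MeasureTheory

attribute [summit_statement] _root_.Crystallization

/-- item stmt-AtomisticToContinuum-6332 · target · rank 0 · closed · moot by None · by planner
why it might fail: STICKY only if KissingFourClassification is wrong in print; MIE if for every q some arrangement with ≤ 24 near-contacts but a denser second shell beats a*(q)·D4 in the r^(−q) tail, or if 4-D Mie ground states keep a positive defect density (then Blanc–Lewin (ii) fails in the exact-lattice form).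
sources: DeLaatLeijenhorstDeMuinckKeizer2024, Musin2008, HeitmannRadin1980, Theil2006, BlancLewin2015, Hoy2024
[target] X = STICKY ∧ MIE as in § Thesis: (STICKY) E_hc(N)/N → −12 for contact-maximising packings
of R^4, −12 = min of the sticky energy per particle over periodic packings, attained by D4, and
translated subsequences of contact-maximising packings converge locally to the counting measure of
one rotated D4 (multiplicity one); (MIE) ∃ q₀ ∀ q ≥ q₀, HasPeriodicGroundStateEnergy V_q 4 ∧
IsCrystallizing V_q 4 for the Mie potential V_q(r) = r^(−2q)/(2q) − r^(−q)/q. Analogue rung: does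
not imply the d = 3 summit. -/
@[route_item "route-AtomisticToContinuum-SlackFreeD4"]
def D4Crystallization : Prop :=
  ((Filter.Tendsto (fun N : ℕ => (⨅ x : {x : Fin N → EuclideanSpace ℝ (Fin 4) // ∀ i j : Fin N, i ≠ j → 1 ≤ dist (x i) (x j)}, Literature.MathematicalPhysics.StatisticalMechanics.interactionEnergy Literature.MathematicalPhysics.StatisticalMechanics.stickyPotential x.1) / (N : ℝ)) Filter.atTop (nhds (-12))) ∧ (∀ P : Literature.MathematicalPhysics.StatisticalMechanics.PeriodicConfiguration 4, (∀ a ∈ P.points, ∀ b ∈ P.points, dist a b < 1 → a = b) → (-12 : ℝ) ≤ P.energyPerParticle Literature.MathematicalPhysics.StatisticalMechanics.stickyPotential) ∧ (∃ P : Literature.MathematicalPhysics.StatisticalMechanics.PeriodicConfiguration 4, P.points = {u : EuclideanSpace ℝ (Fin 4) | ∃ z : Fin 4 → ℤ, Even (∑ k, z k) ∧ ∀ k, u k = (z k : ℝ) / Real.sqrt 2} ∧ P.energyPerParticle Literature.MathematicalPhysics.StatisticalMechanics.stickyPotential = -12) ∧ (∀ x : (N : ℕ) → (Fin N → EuclideanSpace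 ℝ (Fin 4)), (∀ N, ((∀ i j : Fin N, i ≠ j → 1 ≤ dist ((x N) i) ((x N) j)) ∧ ∀ y : Fin N → EuclideanSpace ℝ (Fin 4), (∀ i j : Fin N, i ≠ j → 1 ≤ dist (y i) (y j)) → Literature.MathematicalPhysics.StatisticalMechanics.interactionEnergy Literature.MathematicalPhysics.StatisticalMechanics.stickyPotential (x N) ≤ Literature.MathematicalPhysics.StatisticalMechanics.interactionEnergy Literature.MathematicalPhysics.StatisticalMechanics.stickyPotential y)) → ∃ (φ : ℕ → ℕ) (τ : ℕ → EuclideanSpace ℝ (Fin 4)) (A : EuclideanSpace ℝ (Fin 4) ≃ₗᵢ[ℝ] EuclideanSpace ℝ (Fin 4)), StrictMono φ ∧ ∀ f : EuclideanSpace ℝ (Fin 4) → ℝ, Continuous f → HasCompactSupport f → Filter.Tendsto (fun j => ∑ i : Fin (φ j), f (x (φ j) i + τ j)) Filter.atTop (nhds (∑' s : ↥(A '' {u : EuclideanSpace ℝ (Fin 4) | ∃ z : Fin 4 → ℤ, Even (∑ k, z k) ∧ ∀ k, u k = (z k : ℝ) / Real.sqrt 2}), f s.1)))) ∧ (∃ q₀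 : ℕ, ∀ q : ℕ, q₀ ≤ q → Literature.MathematicalPhysics.StatisticalMechanics.HasPeriodicGroundStateEnergy (fun r : ℝ => (r⁻¹) ^ (2 * q) / (2 * (q : ℝ)) - (r⁻¹) ^ q / (q : ℝ)) 4 ∧ Literature.MathematicalPhysics.StatisticalMechanics.IsCrystallizing (fun r : ℝ => (r⁻¹) ^ (2 * q) / (2 * (q : ℝ)) - (r⁻¹) ^ q / (q : ℝ)) 4)

/-- item stmt-AtomisticToContinuum-6333 · crux · rank 2 · closed · moot by None · by planner
why it might fail: Only if the published exact SDP certificate (arXiv:2404.18794 §5.1: rational affine constraints, PSD factors B·X·Bᵀ checked by Cholesky in ball arithmetic, Sturm sequences for p₂) is in error; the Lean debt (degree-16 zonal matrices) is XL — a formal risk, not a mathematical one.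
sources: Musin2008, DeLaatLeijenhorstDeMuinckKeizer2024, arXiv:2404.18794, ConwaySloane1999
[crux] NAMED FACT IN PRINT, isolated as the first crux because it is the only input of the line not
proved in Lean: (i) k(4) = 24 — at most 24 unit vectors of R^4 are pairwise at distance ≥ 1 (Musin
2008, Theorem; also the objective value 24 of the exact Lasserre-2 solution of arXiv:2404.18794);
(ii) every configuration of 24 unit vectors pairwise at distance ≥ 1 is the image of the normalised
D4 root system 2^(−1/2)·(integer z with Σ z_k² = 2) under a linear isometry (de Laat–Leijenhorst–de
Muinck Keizer 2024, Lemma 5.1: all inner products in −1, ±1/2, 0; Theorem 5.3: root-system closure,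
or Cohn's three-orthonormal-bases argument). Formal debt = verification of the public rational
certificate (Julia/Nemo data of arXiv:2404.18794 §5.1) or a Lean port of Musin's proof; no
mathematical novelty is claimed for this item. [difficulty: XL] -/
@[route_item "route-AtomisticToContinuum-SlackFreeD4"]
def KissingFourClassification : Prop :=
  (∀ S : Finset (EuclideanSpace ℝ (Fin 4)), (∀ x ∈ S, ‖x‖ = 1) → (∀ x ∈ S, ∀ y ∈ S, x ≠ y → 1 ≤ dist x y) → S.card ≤ 24) ∧ (∀ S : Finset (EuclideanSpace ℝ (Fin 4)), (∀ x ∈ S, ‖x‖ = 1) → (∀ x ∈ S, ∀ y ∈ S, x ≠ y → 1 ≤ dist x y) → S.card = 24 → ∃ A : EuclideanSpace ℝ (Fin 4) ≃ₗᵢ[ℝ] EuclideanSpace ℝ (Fin 4), (↑S : Set (EuclideanSpace ℝ (Fin 4))) = A '' {u : EuclideanSpace ℝ (Fin 4) | ∃ z : Fin 4 → ℤ, ∑ k, z k ^ 2 = 2 ∧ ∀ k, u k = (z k : ℝ) / Real.sqrt 2})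

/-- item stmt-AtomisticToContinuum-6334 · crux · rank 3 · closed · moot by None · by planner
why it might fail: For fixed q the tail (61 % of e(D4) at q = 6, 24 % at q = 8) must be dominated patch by patch although a*(q) < 1; a denser non-D4 second shell compatible with ≤ 24 near-contacts would break the one-centre step, and Blanc–Lewin (ii) needs an unproved quadratic rigidity modulus of the D4 truss.
sources: Theil2006, FrieseckeJamesMuller2002, CohnJiaoKumarTorquato2011, ELi2008, BlancLewin2015, Hoy2024
[crux] THEIL ONE DIMENSION UP, GIVEN THE GEOMETRY (card N4–N5): assuming the soft Fejes Tóth–D4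
patch property (verbatim the conclusion of support SoftFejesTothFour: for all R, ε there is η such
that every (1−η)-separated S ∋ p all of whose points within R of p have ≥ 24 other points of S
within 1+η is, on the closed ball of radius R−2 about p, ε-close in both directions to p + A(D4) for
a linear isometry A) and KissingFourClassification, there is q₀ such that
HasPeriodicGroundStateEnergy V_q 4 ∧ IsCrystallizing V_q 4 for all q ≥ q₀, V_q(r) = r^(−2q)/(2q) −
r^(−q)/q (tree predicates, d = 4). Intended proof = Theil 2006 with the planar bond-graph
combinatorics replaced by 24-kissing rigidity: minimum distance 1 − η(q) for ground states (Theil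
Lemma 2.2); at most 24 neighbours within 1+η and a bond deficit ≥ 1/2 per defective particle (Theil
Prop. 2.3 ↦ KissingFourClassification (i) + compactness); renormalised potential V*(a) = (1/24)·Σ
over D4∖0 of V_q(a|v|), minimised at a*(q) < 1; defect-free patches enter the harmonic basin of
a*(q)·D4 by the soft patch property and stay Cauchy–Born-close by a quadratic rigidity modulus of
the D4 contact truss (Friesecke–James–Müller type; first -/
@[route_item "route-AtomisticToContinuum-SlackFreeD4"]
def MieD4OfSoftKissing : Prop :=
  (∀ R ε : ℝ, 0 < ε → ∃ η : ℝ, 0 < η ∧ ∀ (S : Set (EuclideanSpace ℝ (Fin 4))) (p : EuclideanSpace ℝ (Fin 4)), p ∈ S → (∀ x ∈ S, ∀ y ∈ S, dist x y < 1 - η → x = y) → (∀ x ∈ S, dist x p ≤ R → 24 ≤ Set.ncard {y ∈ S | y ≠ x ∧ dist y x ≤ 1 + η}) → ∃ A : EuclideanSpace ℝ (Fin 4) ≃ₗᵢ[ℝ] EuclideanSpace ℝ (Fin 4), (∀ z ∈ S, dist z p ≤ R - 2 → ∃ v ∈ {u : EuclideanSpace ℝ (Fin 4) | ∃ z : Fin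 4 → ℤ, Even (∑ k, z k) ∧ ∀ k, u k = (z k : ℝ) / Real.sqrt 2}, dist z (p + A v) ≤ ε) ∧ (∀ v ∈ {u : EuclideanSpace ℝ (Fin 4) | ∃ z : Fin 4 → ℤ, Even (∑ k, z k) ∧ ∀ k, u k = (z k : ℝ) / Real.sqrt 2}, dist (p + A v) p ≤ R - 2 → ∃ z ∈ S, dist z (p + A v) ≤ ε)) → KissingFourClassification → ∃ q₀ : ℕ, ∀ q : ℕ, q₀ ≤ q → Literature.MathematicalPhysics.StatisticalMechanics.HasPeriodicGroundStateEnergy (fun r : ℝ => (r⁻¹) ^ (2 * q) / (2 * (q : ℝ)) - (r⁻¹) ^ q / (q : ℝ)) 4 ∧ Literature.MathematicalPhysics.StatisticalMechanics.IsCrystallizing (fun r : ℝ => (r⁻¹) ^ (2 * q) / (2 * (q : ℝ)) - (r⁻¹) ^ q / (q : ℝ)) 4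

/-- item stmt-AtomisticToContinuum-6335 · crux · rank 4 · closed · moot by None · by planner
why it might fail: Only through a slip in the propagation bookkeeping (a second rotated root system through −r and its 8-point link) or in the boundary layer R−1 < dist ≤ R; both were checked by hand and by computation, and one non-D4 24-kissed packing of R^4 refutes it outright.
sources: DeLaatLeijenhorstDeMuinckKeizer2024, Hales2012, HalesDSP2012, ConwaySloane1999
[crux] THE FEJES TÓTH THEOREM OF R^4, LOCAL PATCH FORM (new; card N2): given
KissingFourClassification, if S ⊂ R^4 has pairwise distances ≥ 1, p ∈ S, and every point of S within
distance R of p is at distance exactly 1 from exactly 24 points of S, then on the closed ball of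
radius R−1 about p the set S coincides with p + A(D4), D4 = 2^(−1/2)·(even-sum integer vectors), for
a linear isometry A. Mechanism (checked by computation in the planner folder): the shell of a
24-kissed point is a rotated root shell (rank 2 (ii)); two touching 24-kissed points x and x+r share
x and the 8 common neighbours x+s with ⟨s,r⟩ = 1/2 — seen from x+r these are the root −r and its
cube link, 9 roots of rank 4 whose reflection closure is all 24 roots — so the neighbour's shell is
the SAME rotated root system (propagation, no branching: contrast the A/B/C choice behind
FejesTothKissingTwelve); every lattice vector w ≠ 0 has a root ρ with ⟨w,ρ⟩ ≥ |ρ|² > |ρ|²/2, so root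
paths with monotone distance to p reach every lattice point of the R-ball (all occupied); the
covering radius 2^(−1/2) < 1 of D4 leaves no room for a non-lattice point inside radius R−1.
Corollary (R → ∞): a packing of R^4 in which every bal -/
@[route_item "route-AtomisticToContinuum-SlackFreeD4"]
def FejesTothFourOfKissing : Prop :=
  KissingFourClassification → ∀ (S : Set (EuclideanSpace ℝ (Fin 4))) (p : EuclideanSpace ℝ (Fin 4)) (R : ℝ), p ∈ S → (∀ x ∈ S, ∀ y ∈ S, dist x y < 1 → x = y) → (∀ x ∈ S, dist x p ≤ R → Set.ncard {y ∈ S | dist y x = 1} = 24) → ∃ A : EuclideanSpace ℝ (Fin 4) ≃ₗᵢ[ℝ] EuclideanSpace ℝ (Fin 4), ∀ z : EuclideanSpace ℝ (Fin 4), dist z p ≤ R - 1 → (z ∈ S ↔ ∃ v ∈ {u : EuclideanSpace ℝ (Fin 4) | ∃ z : Fin 4 → ℤ, Even (∑ k, z k) ∧ ∀ k, u k = (z k : ℝ) / Real.sqrt 2}, z = p + A v)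

/-- item stmt-AtomisticToContinuum-6336 · crux · rank 5 · closed · moot by None · by planner
why it might fail: Hardly, once ranks 2 and 4 stand (counting + pigeonhole); the one trap is the trial-state bound c₄(N) ≥ 12N − C·N^(3/4) for EVERY N (D4 boxes plus a partial layer), which needs explicit lattice-point counting in Lean.
sources: HeitmannRadin1980, BezdekKhan2018, Bezdek2011, Hales2012
[crux] FINITE-N CORE OF THE STICKY RUNG (card N3): given FejesTothFourOfKissing and
KissingFourClassification, for every R there is N₀ such that every contact-maximising packing x of N
≥ N₀ unit-diameter balls in R^4 (a minimiser of the tree's sticky energy among configurations with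
pairwise distances ≥ 1) has a centre x_i around which, on the closed R-ball, the configuration is
EXACTLY x_i + A(D4) for a linear isometry A. Proof plan (Heitmann–Radin contact budget): contacts ≤
24 per ball (rank 2 (i)) and D4 boxes with a partial layer give 12N − C·N^(3/4) ≤ c₄(N) ≤ 12N, so at
most 2C·N^(3/4) balls are not 24-kissed; a 1-separated set has ≤ c·(R+2)⁴ points in an (R+1)-ball,
so for N > (2cC(R+3)⁴)⁴ some ball sees only 24-kissed balls within R+1, and rank 4 gives the window.
[deps: KissingFourClassification, FejesTothFourOfKissing] [difficulty: M] -/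
@[route_item "route-AtomisticToContinuum-SlackFreeD4"]
def HardStickyWindows : Prop :=
  FejesTothFourOfKissing → KissingFourClassification → ∀ R : ℝ, ∃ N₀ : ℕ, ∀ N : ℕ, N₀ ≤ N → ∀ x : Fin N → EuclideanSpace ℝ (Fin 4), ((∀ i j : Fin N, i ≠ j → 1 ≤ dist (x i) (x j)) ∧ ∀ y : Fin N → EuclideanSpace ℝ (Fin 4), (∀ i j : Fin N, i ≠ j → 1 ≤ dist (y i) (y j)) → Literature.MathematicalPhysics.StatisticalMechanics.interactionEnergy Literature.MathematicalPhysics.StatisticalMechanics.stickyPotential x ≤ Literature.MathematicalPhysics.StatisticalMechanics.interactionEnergy Literature.MathematicalPhysics.StatisticalMechanics.stickyPotential y) → ∃ i : Fin N, ∃ A : EuclideanSpace ℝ (Fin 4) ≃ₗᵢ[ℝ] EuclideanSpace ℝ (Fin 4), ∀ z : EuclideanSpace ℝ (Fin 4), dist z (x i) ≤ R → (z ∈ Set.range x ↔ ∃ v ∈ {u : EuclideanSpace ℝ (Fin 4) | ∃ z : Fin 4 → ℤ, Even (∑ k, z k) ∧ ∀ k, u k = (z k : ℝ) / Real.sqrt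 2}, z = x i + A v)

/-- item stmt-AtomisticToContinuum-6337 · support · rank 9 · closed · moot by None · by planner
sources: BlancLewin2015, HeitmannRadin1980
[support] GLUE FOR STICKY: KissingFourClassification → FejesTothFourOfKissing → HardStickyWindows →
STICKY (verbatim the first conjunct of the target). Energy part: −12N ≤ E_hc(N) (rank 2 (i)) and
E_hc(N) ≤ −12N + C·N^(3/4) (D4 boxes); periodic packings have ≤ 24 contacts per point (rank 2 (i)),
so e ≥ −12, and the PeriodicConfiguration with lattice D4 and motif 0 has e = −12 (24 minimal
vectors, nothing else within range). Positional part: radii R_j = j, indices φ(j) ≥ N₀(j+1) strictly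
increasing, τ_j = −(window centre), rotations A_j from HardStickyWindows; extract A_j → A in the
compact group O(4); for f supported in B(0,R₀) the sums are eventually the FINITE sums Σ over v ∈ D4
with |v| ≤ R₀+1 of f(A_j v) → Σ f(A v) = ∑' over A(D4) by continuity of f (no approximate matching
needed; CrystallizationLocalLimit has the periodic-measure API if the Blanc–Lewin shape with
PeriodicConfiguration.isometryImage is preferred). [difficulty: provable-now] -/
@[route_item "route-AtomisticToContinuum-SlackFreeD4"]
def StickyD4OfWindows : Prop :=
  KissingFourClassification → FejesTothFourOfKissing → HardStickyWindows → (Filter.Tendsto (fun N : ℕ => (⨅ x : {x : Fin N → EuclideanSpace ℝ (Fin 4) // ∀ i j : Fin N, i ≠ j → 1 ≤ dist (x i) (x j)}, Literature.MathematicalPhysics.StatisticalMechanics.interactionEnergy Literature.MathematicalPhysics.StatisticalMechanics.stickyPotential x.1) / (N : ℝ)) Filter.atTop (nhds (-12))) ∧ (∀ P : Literature.MathematicalPhysics.StatisticalMechanics.PeriodicConfiguration 4, (∀ a ∈ P.points, ∀ b ∈ P.points, dist a b < 1 → a = b) → (-12 : ℝ) ≤ P.energyPerParticle Literature.MathematicalPhysics.StatisticalMechanics.stickyPotential)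 ∧ (∃ P : Literature.MathematicalPhysics.StatisticalMechanics.PeriodicConfiguration 4, P.points = {u : EuclideanSpace ℝ (Fin 4) | ∃ z : Fin 4 → ℤ, Even (∑ k, z k) ∧ ∀ k, u k = (z k : ℝ) / Real.sqrt 2} ∧ P.energyPerParticle Literature.MathematicalPhysics.StatisticalMechanics.stickyPotential = -12) ∧ (∀ x : (N : ℕ) → (Fin N → EuclideanSpace ℝ (Fin 4)), (∀ N, ((∀ i j : Fin N, i ≠ j → 1 ≤ dist ((x N) i) ((x N) j)) ∧ ∀ y : Fin N → EuclideanSpace ℝ (Fin 4), (∀ i j : Fin N, i ≠ j → 1 ≤ dist (y i) (y j)) → Literature.MathematicalPhysics.StatisticalMechanics.interactionEnergy Literature.MathematicalPhysics.StatisticalMechanics.stickyPotential (x N) ≤ Literature.MathematicalPhysics.StatisticalMechanics.interactionEnergy Literature.MathematicalPhysics.StatisticalMechanics.stickyPotential y)) → ∃ (φ : ℕ → ℕ) (τ : ℕ → EuclideanSpace ℝ (Fin 4)) (A : EuclideanSpace ℝ (Fin 4) ≃ₗᵢ[ℝ] EuclideanSpace ℝ (Fin 4)), StrictMono φ ∧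 ∀ f : EuclideanSpace ℝ (Fin 4) → ℝ, Continuous f → HasCompactSupport f → Filter.Tendsto (fun j => ∑ i : Fin (φ j), f (x (φ j) i + τ j)) Filter.atTop (nhds (∑' s : ↥(A '' {u : EuclideanSpace ℝ (Fin 4) | ∃ z : Fin 4 → ℤ, Even (∑ k, z k) ∧ ∀ k, u k = (z k : ℝ) / Real.sqrt 2}), f s.1)))

/-- item stmt-AtomisticToContinuum-6338 · support · rank 9 · closed · moot by None · by planner
sources: CohnJiaoKumarTorquato2011, DeLaatLeijenhorstDeMuinckKeizer2024, KusnerKusnerLagariasShlosman2018, Hales2012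
[support] SOFT FEJES TÓTH–D4 BY COMPACTNESS (qualitative robust 24-kissing, the d = 4 counterpart of
crux RobustFejesTothHales of route CrystalKissingRigidity — here a corollary, because s₄ = 0): given
FejesTothFourOfKissing and KissingFourClassification, for all R and ε > 0 there is η > 0 such that
every (1−η)-separated S ∋ p all of whose points within R of p have at least 24 other points of S
within 1+η is, on the closed ball of radius R−2 about p, ε-close to p + A(D4) in both directions
(every point within ε of a site, every site within ε of a point), for a linear isometry A. Proof:
contradiction sequence η_n → 0; translate p to 0; the boundedly many points in the closed (R+3)-ball
converge along a subsequence; the limit is a packing whose points within R − 1/2 of 0 are exactly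
24-kissed (≥ 24 limit neighbours at distance ≤ 1, hence = 1 and ≤ 24 by rank 2 (i)), so rank 4 pins
it on the closed (R−3/2)-ball ⊇ (R−2)-ball, contradiction. A LINEAR modulus ε ≤ C(R)·η follows near
each shell from infinitesimal jamming of the D4 root system (Cohn–Jiao–Kumar–Torquato 2011, Prop.
3.1) and is left to layer 2. [difficulty: provable-now] -/
@[route_item "route-AtomisticToContinuum-SlackFreeD4"]
def SoftFejesTothFour : Prop :=
  FejesTothFourOfKissing → KissingFourClassification → ∀ R ε : ℝ, 0 < ε → ∃ η : ℝ, 0 < η ∧ ∀ (S : Set (EuclideanSpace ℝ (Fin 4))) (p : EuclideanSpace ℝ (Fin 4)), p ∈ S → (∀ x ∈ S, ∀ y ∈ S, dist x y < 1 - η → x = y) → (∀ x ∈ S, dist x p ≤ R → 24 ≤ Set.ncard {y ∈ S | y ≠ x ∧ dist y x ≤ 1 + η}) → ∃ A : EuclideanSpace ℝ (Fin 4) ≃ₗᵢ[ℝ] EuclideanSpace ℝ (Fin 4), (∀ z ∈ S, dist z p ≤ R - 2 → ∃ v ∈ {u : EuclideanSpace ℝ (Fin 4) | ∃ z : Fin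 4 → ℤ, Even (∑ k, z k) ∧ ∀ k, u k = (z k : ℝ) / Real.sqrt 2}, dist z (p + A v) ≤ ε) ∧ (∀ v ∈ {u : EuclideanSpace ℝ (Fin 4) | ∃ z : Fin 4 → ℤ, Even (∑ k, z k) ∧ ∀ k, u k = (z k : ℝ) / Real.sqrt 2}, dist (p + A v) p ≤ R - 2 → ∃ z ∈ S, dist z (p + A v) ≤ ε)

/-- item stmt-AtomisticToContinuum-6339 · support · rank 9 · closed · moot by None · by planner
sources: BlancLewin2015, doi:10.1007/s00454-008-9082-x
[support] WHY THE RUNG IS TYPED WITH A HARD CORE (negative, provable now): the tree's finite-penalty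
stickyPotential (+1 on [0,1), −1 at 1, 0 beyond; StickyChain.lean, meant for d = 1) is
catastrophically unstable in R^4, hence ¬HasPeriodicGroundStateEnergy stickyPotential 4: Lenz's two
orthogonal circles of radius 2^(−1/2) (coordinates 1–2 and 3–4) carry 2m + 2m RATIONAL points
arranged as two tight antipodal clusters per circle; all 4m² cross pairs are at distance exactly 1
and only the 2m² − 2m intra-cluster pairs are closer than 1, so E(4m) ≤ (2m² − 2m) − 4m² = −2m² − 2m
and E(N)/N is unbounded below (groundStateEnergy_le_of_le with c = −1), whereas convergence of
E(N)/N to the finite energy per particle of some periodic configuration is what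
HasPeriodicGroundStateEnergy asserts. (The d = 1 theorems of StickyChainCrystallization are
unaffected; in d = 4 the hard core must be a constraint.) [difficulty: provable-now] -/
@[route_item "route-AtomisticToContinuum-SlackFreeD4"]
def PenaltyStickyUnstableFour : Prop :=
  ¬ Literature.MathematicalPhysics.StatisticalMechanics.HasPeriodicGroundStateEnergy Literature.MathematicalPhysics.StatisticalMechanics.stickyPotential 4

/-- item stmt-AtomisticToContinuum-6340 · assembly · rank 1 · closed · moot by None · by planner
sources: BlancLewin2015, HeitmannRadin1980, Theil2006
[assembly] KissingFourClassification → FejesTothFourOfKissing → HardStickyWindows →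
StickyD4OfWindows → SoftFejesTothFour → MieD4OfSoftKissing → D4Crystallization (the rung target; the
summit conjunct is not claimed). -/
@[route_item "route-AtomisticToContinuum-SlackFreeD4"]
def Assembly : Prop :=
  KissingFourClassification → FejesTothFourOfKissing → HardStickyWindows → StickyD4OfWindows → SoftFejesTothFour → MieD4OfSoftKissing → D4Crystallization

end Summit.AtomisticToContinuum.Crystallization.Theses.SlackFreeD4
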